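import Summits.BirchSwinnertonDyer.BirchSwinnertonDyer.Theorems.AdditiveBranchIMCMultLowerCruxShape
import Summits.BirchSwinnertonDyer.BirchSwinnertonDyer.Theorems.AdditiveBranchIMCGordTwoRankZeroCongruence
import Summits.BirchSwinnertonDyer.Rank1Residual.Partition.CellOf
import Literature.NumberTheory.EllipticCurves.EmertonPollackWeston2006.BranchTransferSemistable
import HarnessLib

/-!
# Crux `MultLower` (item 19359) / child `MultLambdaLower` (item 19590): a PUBLISHED road to the Λ-adic
# lower containment at the MULTIPLICATIVE twist model — Emerton–Pollack–Weston 2006 Cor. 5.1.4 on the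
# branch `ω^{(p−1)/2}` between SEMISTABLE members, with a free base case from Kato at a congruent curve
# whose branch `p`-adic `L`-function is a unit

Cell `bsd-addord`, seat `bsd-addord-k1-c4` (D-0074 row B3), gen 3; sequel of
`AdditiveBranchIMCMultLower{CruxShape,LambdaAdic,LambdaAdicIff,…}` (gens 0/2) and the (M) twin of
k1-c2's `AdditiveBranchIMCGordTwoRankZeroCongruence` (cell (G-ord, `e = 2`)). HONEST FRAMING: nothing
here proves the Birch–Swinnerton-Dyer conjecture, the crux or its Λ-adic child; every published input is
an explicit named-fact binder — Kato's divisibility at a semistable prime read on the `χ_K`-half-eigenspace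
(`hKW`, the tree's READING fact `Wuthrich2014.kato_halfEigenCharIdeal_dvd_cyclotomicPrime_of_surjective`,
good ordinary OR multiplicative `p`, `ρ_{V,p^∞}` tower-surjective), the NEW reading fact
`EmertonPollackWeston2006.cor514_branchTransfer_semistable_of_torsionIso` (`hEPW`: Invent. Math. 163 (2006)
Cor. 5.1.4 + Thm. 5.1.3 on the branch `i = (p−1)/2` between weight-two members of `H(ρ̄)` that are good
ordinary OR MULTIPLICATIVE at `p ≥ 5` — the authors' own Ex. 5.3.1 is `X₀(11)` at its split multiplicative
prime `11`; same half-eigen vocabulary as `hKW`), and the route's facts `hDelX hPal hGZK hmod hmodD`; and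
two PER-PAIR CERTIFICATES, displayed as binders and never asserted: (C1) a `Γ_ℚ`-equivariant isomorphism
`V₁[p] ≃ V[p]` from a fixed semistable PARTNER `V₁` (good ordinary or multiplicative at `p`, `ρ_{V₁,pⁿ}`
onto for all `n`) to the multiplicative twist models `V` of the additive curve `W` (`C • V^{(p*)} = W`), and
(C2) the constant term of `ϖ₁·L_p^{br}(f_{V₁})` — the `ω^{(p−1)/2}`-branch of the measure of `V₁`'s
reduction type, Néron-normalised — is a `p`-adic UNIT (one modular-symbol sum). Nothing is booked here.

THE ROAD. On the branch `m = (p−1)/2` the main conjecture for `f_V ⊗ ω^m` is EPW's statement 5.1.1;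
Kato's Thm. 5.1.2 (here: `hKW`, Kato 12.5 (4) as attributed by Wuthrich Thm. 3 / Cor. 19, semistable `p`)
gives one divisibility for every tower-surjective member; so for a member `f_{V₁}` whose branch `p`-adic
`L`-function is a UNIT of `Λ`, Kato's element is a unit and 5.1.1 holds trivially with `μ = λ = 0` (§1).
EPW Cor. 5.1.4 (branch `m`) transports 5.1.1 — with `μ = 0` by Thm. 5.1.3 — to EVERY member of `H(ρ̄)`,
in particular to the MULTIPLICATIVE twist model `V` of the cell-(M) curve `W = C • V^{(p*)}` (§2): there
`char_Λ e_m X(V/ℚ(μ_{p^∞})) = (g)`, `ι g = ϖ·L_p^{br}(f_V)` is the FULL branch main conjecture at `p ∥ N_V`,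
hence the cell's typed Λ-adic input `QuadraticBranchLowerDivisibilityAt V p` (= the content of child
19590 at the pair), and, in analytic rank `0`, `MissingLowerBoundAt W p` by gen 2's
`missingLowerBoundAt_rankZero_of_cellM_of_quadraticBranchLower` (§3). §4 states the child 19590 and the
rank-`0` half of the crux BY NAME modulo the displayed ∀-partner demand (p ≥ 5; the `p = 3` rows of cell
(M) keep their raw input — EPW's Hida theory is printed for `p ≥ 5`). Reach (EPW §5): exactly the
residual classes `ρ̄` with `μ(ρ̄, ω^m) = 0` and MINIMAL `λ(ρ̄, ω^m) = 0` witnessed by a rational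
semistable weight-two member with unit branch `L`-value; on a content row (`p ∣ #Ш(W)_an`) the conclusion
is NOT trivial (it forces `ord_p #Ш(W) ≥ 1`). If `V[p]|_{G_{ℚ_p}}` is très ramifié (`p ∤ ord_p Δ_V`) no
good-reduction partner exists and the partner must itself be multiplicative at `p` — which is why the
transfer fact and the base case are typed for SEMISTABLE members, not good ordinary ones.

* §1 `branchCharIdealMuZeroHalfEigen_of_katoHalf_of_unit` — base case at the partner: `hKW` +
  tower-surjectivity + (C2) ⟹ `BranchCharIdealMuZeroHalfEigen V₁ p`.
* §2 `quadraticBranchLowerDivisibilityAt_of_branchTransferSemistable`: `hEPW` + the partner's 5.1.1 +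
  (C1) ⟹ `QuadraticBranchLowerDivisibilityAt V p` at ANY semistable `V` with `V₁[p] ≃ V[p]` (indeed the
  full equality `char = (g)`, `ι g = ϖ·B`).
* §3 `missingLowerBoundAt_rankZero_of_cellM_of_partner`: cell (M), `r_an = 0`, `p ≥ 5` ⟹
  `ord_p #Ш(W)_an ≤ ord_p #Ш(W)` from the facts and the two certificates.
* §4 `multLambdaLower_of_katoHalf_of_branchTransfer_of_partners` (item 19590 BY NAME modulo the demand),
  `lowerHalfM_of_facts_of_partners` (the registered `stub_rankZero` = `N10.LowerHalfM` modulo the demand on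
  CONTENT rows only).

References: Emerton–Pollack–Weston, Invent. Math. 163 (2006) Cor. 5.1.4, Thm. 5.1.3, Thm. 5.1.2, Ex. 5.3.1
[EmertonPollackWeston2006]; Kato, Astérisque 295 (2004) Thm. 12.5 (4), 17.4 [Kato2004Asterisque]; Wuthrich,
Doc. Math. 19 (2014) Thm. 3, Cor. 19 [Wuthrich2014]; Greenberg, LNM 1716 (1999) §2, §5 [GreenbergLNM1716];
Mazur–Tate–Teitelbaum 1986 §I.10, §I.13–14 [MazurTateTeitelbaum1986Invent]; Delbourgo 1998 Prop. 4
[Delbourgo1998]; Pal 2012 Thm. 3.2 [Pal2012]; Miller 2011 Def. 1.1 [Miller2011LMS].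
-/

set_option autoImplicit false
set_option linter.dupNamespace false

noncomputable section

open scoped Classical MatrixGroups ModularForm

open CongruenceSubgroup WeierstrassCurve
  Literature.NumberTheory.EllipticCurves
  Literature.NumberTheory.EllipticCurves.ModularForms
  Literature.NumberTheory.EllipticCurves.Rank1Residual
  Literature.NumberTheory.EllipticCurves.Rank1Residual.Typed
  Literature.NumberTheory.EllipticCurves.GreenbergVatsal2000
  Literature.NumberTheory.EllipticCurves.EmertonPollackWeston2006
  Literature.NumberTheory.GaloisRepresentations

namespace Summit.BirchSwinnertonDyer.BirchSwinnertonDyer.Theorems.AdditiveBranchIMCMultLowerCongruence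

open Summit.BirchSwinnertonDyer.Rank1Residual
open Summit.BirchSwinnertonDyer.Rank1Residual.Additive
open Summit.BirchSwinnertonDyer.Rank1Residual.AdditivePotMult
open Summit.BirchSwinnertonDyer.BirchSwinnertonDyer.Theses.AdditiveBranchIMC
open Summit.BirchSwinnertonDyer.BirchSwinnertonDyer.Theorems.AdditiveBranchIMCMultLower
open Summit.BirchSwinnertonDyer.BirchSwinnertonDyer.Theorems.AdditiveBranchIMCGordTwoRankZeroCongruence

variable {p : ℕ} [hp : Fact p.Prime]

/-! ## §1 The base case at the partner: Kato (semistable `p`, half-eigenspace) + a unit branch `L`-function -/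

/-- **Base case (EPW's statement 5.1.1 with `μ = λ = 0`) at a SEMISTABLE curve whose branch `p`-adic
`L`-function is a unit.** For `V₁/ℚ` globally minimal, good ordinary or multiplicative at the odd prime
`p`, with `ρ_{V₁,pⁿ}` onto for every `n`, IF for every newform / branch / period normalisation `(f₁, B, ϖ₁)`
of the half-eigen fact (two-term unit-root branch if good ordinary, one-term `a = ±1` branch if split /
non-split multiplicative; plus / minus symbols by the parity of `(p−1)/2`) the constant term of `ϖ₁·B` has
`p`-adic norm `1` — certificate (C2), ONE modular-symbol sum — THEN `BranchCharIdealMuZeroHalfEigen V₁ p`: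
for every half-eigen datum `D`, `D.X` is torsion and `D.charIdeal = (g₁)` with `HasUnitContent g₁` and
`ι g₁ = ϖ₁·B`. Proof: `hKW` gives `g ∈ D.charIdeal` with `ι g = u·ϖ₁·B`; its constant term is a unit, so
`g ∈ Λ^×`, `D.charIdeal = Λ`, and `g₁ := u⁻¹g` works. (The reduction type is read off the disjunct, so no
reduction hypothesis is displayed.) [cite: Kato2004Asterisque, Thm. 12.5 (4) (p. 222), Thm. 17.4 (3) (p. 273)]
[cite: Wuthrich2014, Thm. 3 (p. 383), Cor. 19 (pp. 398–399)]
[cite: EmertonPollackWeston2006, Thm. 5.1.2 and statement 5.1.1 (arXiv p30)] -/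
theorem branchCharIdealMuZeroHalfEigen_of_katoHalf_of_unit
    (hKW : Wuthrich2014.kato_halfEigenCharIdeal_dvd_cyclotomicPrime_of_surjective)
    (V₁ : WeierstrassCurve ℚ) [V₁.IsElliptic] [V₁.IsGloballyMinimal]
    (hsurj : ∀ n : ℕ, V₁.HasSurjectiveModNGaloisRep (p ^ n : ℕ))
    (hunit : ∀ {N : ℕ} [NeZero N] (f : CuspForm (Gamma0 N) 2) (B : PowerSeries ℚ_[p]),
      IsNewformOf V₁ f →
      ((IsOrdinaryAt V₁ p ∧
          B = if Even (p / 2) then padicLFunctionBranch f ((unitRoot V₁ p : ℤ_[p]) : ℚ_[p]) (p / 2)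
            else padicLFunctionMinusBranch f ((unitRoot V₁ p : ℤ_[p]) : ℚ_[p]) (p / 2)) ∨
        (V₁.HasSplitMultiplicativeReductionAtPrime p ∧
          B = if Even (p / 2) then padicLFunctionPlusBranchMult f (1 : ℚ_[p]) (p / 2)
            else padicLFunctionMinusBranchMult f (1 : ℚ_[p]) (p / 2)) ∨
        (V₁.HasMultiplicativeReductionAtPrime p ∧ ¬ V₁.HasSplitMultiplicativeReductionAtPrime p ∧
          B = if Even (p / 2) then padicLFunctionPlusBranchMult f (-1 : ℚ_[p]) (p / 2)
            else padicLFunctionMinusBranchMult f (-1 : ℚ_[p]) (p / 2))) →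
      ∀ (ϖ : ℚ), (if Even (p / 2) then (ϖ : ℝ) * V₁.realPeriodRat = plusPeriod f
        else (ϖ : ℝ) * V₁.imaginaryPeriodRat = minusPeriod f) →
      ‖PowerSeries.constantCoeff (PowerSeries.C (ϖ : ℚ_[p]) * B)‖ = 1) :
    BranchCharIdealMuZeroHalfEigen V₁ p := by
  intro K _ _ _ F _ _ _ _ κ γ N _ f B hp2 hK2 hθ hB hκ hγ hcv hγK hγF hf D ϖ hϖ
  obtain ⟨htor, g, hgmem, u, hιg⟩ :=
    hKW p V₁ K F B hp2 hK2 hθ hB hsurj hκ hγ hcv hγK hγF hf D ϖ hϖ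
  have hcert := hunit f B hf hB ϖ hϖ
  -- the constant term of `ι g` is `u` times that of `ϖ·B`, hence a unit
  have hgunit : IsUnit g := by
    apply isUnit_of_norm_constantCoeff_iwasawaToPowerSeries_eq_one
    have h1 : ‖PowerSeries.constantCoeff (PowerSeries.C (ϖ : ℚ_[p]) * B)‖ = 1 := hcert
    rw [map_mul, PowerSeries.constantCoeff_C] at h1
    have hu : ‖((u : ℤ_[p]) : ℚ_[p])‖ = 1 := by
      rw [PadicInt.padic_norm_e_of_padicInt]; exact PadicInt.isUnit_iff.mp (Units.isUnit u)
    rw [hιg, map_mul, PowerSeries.constantCoeff_C, mul_assoc, norm_mul, hu, one_mul, h1]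
  refine ⟨htor, PowerSeries.C (((u⁻¹ : ℤ_[p]ˣ) : ℤ_[p])) * g, ?_, ?_, ?_⟩
  · -- `D.charIdeal = Λ = (u⁻¹ g)`
    have htop : D.charIdeal = ⊤ := Ideal.eq_top_of_isUnit_mem _ hgmem hgunit
    rw [htop, eq_comm, Ideal.span_singleton_eq_top]
    exact ((Units.isUnit u⁻¹).map PowerSeries.C).mul hgunit
  · -- unit content: the constant coefficient is a unit
    refine ⟨0, ?_⟩
    rw [PowerSeries.coeff_zero_eq_constantCoeff]
    exact PowerSeries.isUnit_iff_constantCoeff.mp (((Units.isUnit u⁻¹).map PowerSeries.C).mul hgunit)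
  · rw [map_mul, hιg, ← mul_assoc, AdditiveBranchIMCGordTwoRankZeroLambdaAdic.iwasawaToPowerSeries_C,
      ← map_mul, ← mul_assoc, ← PadicInt.coe_mul, Units.inv_mul, PadicInt.coe_one, one_mul]

/-! ## §2 The transfer: the Λ-adic lower input at ANY congruent semistable curve — in particular at the
multiplicative twist model of a cell-(M) curve -/

/-- **`QuadraticBranchLowerDivisibilityAt V p` from EPW Cor. 5.1.4 on the branch and a semistable partner
(`p ≥ 5`).** Let `V₁` be a globally minimal PARTNER, good ordinary or multiplicative at `p`, with `V₁[p]`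
irreducible, satisfying EPW's 5.1.1 with `μ = 0` on the branch (`hBr₁`, e.g. from §1), and let `V` be any
globally minimal curve with a `Γ_ℚ`-equivariant `V₁[p] ≃ V[p]` ((C1)). Then the cell's typed Λ-adic input
holds at `V`: for every datum of the conjecture, every `g ∈ char_Λ e_m X(V/ℚ(μ_{p^∞}))` is `h·(ϖ·B)` —
indeed `char = (g₀)` with `ι g₀ = ϖ·B`, by `hEPW` (5.1.1 for `f_V ⊗ ω^m`, half-eigen model; the reduction
type of `V` — good ordinary, split or non-split multiplicative — is read off the conjecture's own
disjunct) and `ChiEigenSelmerInDualData.toEigen` (same module). For a cell-(M) curve `W = C • V^{(p*)}`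
this is the content of child 19590 `MultLambdaLower` AT THE PAIR. CONDITIONAL on the displayed inputs;
closes nothing. [cite: EmertonPollackWeston2006, Cor. 5.1.4 and Thm. 5.1.3 (arXiv p30), Ex. 5.3.1 (p32)]
[cite: SkinnerUrban2014, Thm. 3.6.4 (shape only)] [cite: GreenbergLNM1716, §5 (PDF p. 143)] -/
theorem quadraticBranchLowerDivisibilityAt_of_branchTransferSemistable
    (hEPW : EmertonPollackWeston2006.cor514_branchTransfer_semistable_of_torsionIso) (hp5 : 5 ≤ p)
    (V₁ : WeierstrassCurve ℚ) [V₁.IsElliptic] [V₁.IsGloballyMinimal]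
    (hred₁ : IsOrdinaryAt V₁ p ∨ V₁.HasMultiplicativeReductionAtPrime p)
    (hirr₁ : V₁.HasIrreducibleModPGaloisRep p) (hBr₁ : BranchCharIdealMuZeroHalfEigen V₁ p)
    (V : WeierstrassCurve ℚ) [V.IsElliptic] [V.IsGloballyMinimal]
    (hiso : ∃ e : geomTorsion V₁ (p : ℤ) ≃+ geomTorsion V (p : ℤ),
      ∀ (σ : Field.absoluteGaloisGroup ℚ) (P : geomTorsion V₁ (p : ℤ)), e (σ • P) = σ • e P) :
    QuadraticBranchLowerDivisibilityAt V p := by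
  intro K _ _ _ F _ _ _ _ κ γ N _ f B hp2 hK2 hθ hB hκ hγ hcv hγK hγF hf D ϖ hϖ g hg
  -- the reduction type of `V` at `p`, read off the disjunct
  have hred : IsOrdinaryAt V p ∨ V.HasMultiplicativeReductionAtPrime p := by
    rcases hB with h | h | h
    · exact Or.inl h.1
    · exact Or.inr h.1.hasMultiplicativeReductionAtPrime
    · exact Or.inr h.1
  -- EPW: the partner's 5.1.1 passes to `V`
  have hBr : BranchCharIdealMuZeroHalfEigen V p := hEPW p V₁ V hp5 hred₁ hred hiso hirr₁ hBr₁
  obtain ⟨-, g₀, hspan, -, hι⟩ := hBr K F B hp2 hK2 hθ hB hκ hγ hcv hγK hγF hf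
    (ChiEigenSelmerInDualData.toEigen V K κ (galRange (K := ℚ) F) γ D) ϖ hϖ
  -- `g ∈ char X = (g₀)`
  have hg' : g ∈ Ideal.span {g₀} := by
    rw [← hspan]
    exact hg
  obtain ⟨h, hh⟩ := Ideal.mem_span_singleton'.mp hg'
  exact ⟨h, by rw [← hh, map_mul, hι]⟩

/-- **The same, with the base case discharged by §1**: `hKW` + `hEPW` + a tower-surjective semistable
partner `V₁` with UNIT branch `p`-adic `L`-function ((C2)) and a `Γ_ℚ`-equivariant `V₁[p] ≃ V[p]` ((C1))
⟹ `QuadraticBranchLowerDivisibilityAt V p` (`p ≥ 5`; `V₁[p]` irreducible because `ρ̄_{V₁,p}` is onto).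
CONDITIONAL on the displayed certificates; closes nothing.
[cite: EmertonPollackWeston2006, Cor. 5.1.4 (arXiv p30), Ex. 5.3.1 (p32)]
[cite: Kato2004Asterisque, Thm. 12.5 (4) (p. 222)] [cite: Wuthrich2014, Thm. 3 (p. 383)] -/
theorem quadraticBranchLowerDivisibilityAt_of_partner
    (hKW : Wuthrich2014.kato_halfEigenCharIdeal_dvd_cyclotomicPrime_of_surjective)
    (hEPW : EmertonPollackWeston2006.cor514_branchTransfer_semistable_of_torsionIso) (hp5 : 5 ≤ p)
    (V₁ : WeierstrassCurve ℚ) [V₁.IsElliptic] [V₁.IsGloballyMinimal]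
    (hred₁ : IsOrdinaryAt V₁ p ∨ V₁.HasMultiplicativeReductionAtPrime p)
    (hsurj₁ : ∀ n : ℕ, V₁.HasSurjectiveModNGaloisRep (p ^ n : ℕ))
    (hunit₁ : ∀ {N : ℕ} [NeZero N] (f : CuspForm (Gamma0 N) 2) (B : PowerSeries ℚ_[p]),
      IsNewformOf V₁ f →
      ((IsOrdinaryAt V₁ p ∧
          B = if Even (p / 2) then padicLFunctionBranch f ((unitRoot V₁ p : ℤ_[p]) : ℚ_[p]) (p / 2)
            else padicLFunctionMinusBranch f ((unitRoot V₁ p : ℤ_[p]) : ℚ_[p]) (p / 2)) ∨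
        (V₁.HasSplitMultiplicativeReductionAtPrime p ∧
          B = if Even (p / 2) then padicLFunctionPlusBranchMult f (1 : ℚ_[p]) (p / 2)
            else padicLFunctionMinusBranchMult f (1 : ℚ_[p]) (p / 2)) ∨
        (V₁.HasMultiplicativeReductionAtPrime p ∧ ¬ V₁.HasSplitMultiplicativeReductionAtPrime p ∧
          B = if Even (p / 2) then padicLFunctionPlusBranchMult f (-1 : ℚ_[p]) (p / 2)
            else padicLFunctionMinusBranchMult f (-1 : ℚ_[p]) (p / 2))) →
      ∀ (ϖ : ℚ), (if Even (p / 2) then (ϖ : ℝ) * V₁.realPeriodRat = plusPeriod f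
        else (ϖ : ℝ) * V₁.imaginaryPeriodRat = minusPeriod f) →
      ‖PowerSeries.constantCoeff (PowerSeries.C (ϖ : ℚ_[p]) * B)‖ = 1)
    (V : WeierstrassCurve ℚ) [V.IsElliptic] [V.IsGloballyMinimal]
    (hiso : ∃ e : geomTorsion V₁ (p : ℤ) ≃+ geomTorsion V (p : ℤ),
      ∀ (σ : Field.absoluteGaloisGroup ℚ) (P : geomTorsion V₁ (p : ℤ)), e (σ • P) = σ • e P) :
    QuadraticBranchLowerDivisibilityAt V p :=
  quadraticBranchLowerDivisibilityAt_of_branchTransferSemistable hEPW hp5 V₁ hred₁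
    (irr_of_surj V₁ p (by simpa using hsurj₁ 1))
    (branchCharIdealMuZeroHalfEigen_of_katoHalf_of_unit hKW V₁ hsurj₁ hunit₁) V hiso

/-! ## §3 Rank `0`: the lower half on cell (M) from the facts and a certified partner -/

/-- **Cell (M), `r_an = 0`, `p ≥ 5` (either parity): `ord_p #Ш(W)_an ≤ ord_p #Ш(W)` from the route's facts,
Kato's half-eigen divisibility, EPW's semistable branch transfer and the two certificates at a
tower-surjective semistable partner** — the shape a per-pair booking would instantiate: PUBLISHED inputs by
name (`hDelX` Delbourgo 1998 Prop. 4 on (M), `hPal` Pal 2012 Thm. 3.2, `hGZK`, `hmod`, `hmodD`, `hKW`,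
`hEPW`) + (C1) `hiso` for every globally minimal twist model `V` of `W` (`C • V^{(p*)} = W`; all such `V` are
`ℚ`-isomorphic, so one isomorphism serves) + (C2) `hunit₁`. Via §2 and gen 2's
`missingLowerBoundAt_rankZero_of_cellM_of_quadraticBranchLower` (p426893). X3♯(M) or X4(M), but the road
only reaches rows whose twist model has SURJECTIVE `ρ̄` (it is congruent to the tower-surjective partner).
[cite: EmertonPollackWeston2006, Cor. 5.1.4 (arXiv p30), Ex. 5.3.1 (p32)] [cite: Kato2004Asterisque, Thm. 12.5 (4) (p. 222)]
[cite: Delbourgo1998, Prop. 4 (p. 144), §2.2 Lemma (ii) (p. 139)] [cite: Pal2012, Thm. 3.2] [cite: Miller2011LMS, Def. 1.1] -/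
theorem missingLowerBoundAt_rankZero_of_cellM_of_partner {W : WeierstrassCurve ℚ} [W.IsElliptic]
    [W.IsGloballyMinimal]
    (hDelX : Delbourgo1998.prop4_rankZero_constantCoeff_eq_unit_mul_of_potMult)
    (hPal : Pal2012.thm32_sqrt_mul_realPeriodRat_twist_eq_of_prime_one_mod_four)
    (hGZK : rank_eq_analyticRank_of_analyticRank_le_one) (hmod : hasEntireLFunction_rat)
    (hmodD : nonempty_modularParametrizationData)
    (hKW : Wuthrich2014.kato_halfEigenCharIdeal_dvd_cyclotomicPrime_of_surjective)
    (hEPW : EmertonPollackWeston2006.cor514_branchTransfer_semistable_of_torsionIso)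
    (hc : N10.CellM W p) (hp5 : 5 ≤ p) (hr : W.analyticRank = 0)
    (V₁ : WeierstrassCurve ℚ) [V₁.IsElliptic] [V₁.IsGloballyMinimal]
    (hred₁ : IsOrdinaryAt V₁ p ∨ V₁.HasMultiplicativeReductionAtPrime p)
    (hsurj₁ : ∀ n : ℕ, V₁.HasSurjectiveModNGaloisRep (p ^ n : ℕ))
    (hunit₁ : ∀ {N : ℕ} [NeZero N] (f : CuspForm (Gamma0 N) 2) (B : PowerSeries ℚ_[p]),
      IsNewformOf V₁ f →
      ((IsOrdinaryAt V₁ p ∧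
          B = if Even (p / 2) then padicLFunctionBranch f ((unitRoot V₁ p : ℤ_[p]) : ℚ_[p]) (p / 2)
            else padicLFunctionMinusBranch f ((unitRoot V₁ p : ℤ_[p]) : ℚ_[p]) (p / 2)) ∨
        (V₁.HasSplitMultiplicativeReductionAtPrime p ∧
          B = if Even (p / 2) then padicLFunctionPlusBranchMult f (1 : ℚ_[p]) (p / 2)
            else padicLFunctionMinusBranchMult f (1 : ℚ_[p]) (p / 2)) ∨
        (V₁.HasMultiplicativeReductionAtPrime p ∧ ¬ V₁.HasSplitMultiplicativeReductionAtPrime p ∧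
          B = if Even (p / 2) then padicLFunctionPlusBranchMult f (-1 : ℚ_[p]) (p / 2)
            else padicLFunctionMinusBranchMult f (-1 : ℚ_[p]) (p / 2))) →
      ∀ (ϖ : ℚ), (if Even (p / 2) then (ϖ : ℝ) * V₁.realPeriodRat = plusPeriod f
        else (ϖ : ℝ) * V₁.imaginaryPeriodRat = minusPeriod f) →
      ‖PowerSeries.constantCoeff (PowerSeries.C (ϖ : ℚ_[p]) * B)‖ = 1)
    (hiso : ∀ (V : WeierstrassCurve ℚ) [V.IsElliptic] [V.IsGloballyMinimal],
      (∃ C : VariableChange ℚ, C • V.quadraticTwist ((-1) ^ (p / 2) * p : ℚ) = W) →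
      ∃ e : geomTorsion V₁ (p : ℤ) ≃+ geomTorsion V (p : ℤ),
        ∀ (σ : Field.absoluteGaloisGroup ℚ) (P : geomTorsion V₁ (p : ℤ)), e (σ • P) = σ • e P) :
    MissingLowerBoundAt W p :=
  missingLowerBoundAt_rankZero_of_cellM_of_quadraticBranchLower hDelX hPal hGZK hmod hmodD hc hr
    fun V _ _ hCW =>
      quadraticBranchLowerDivisibilityAt_of_partner hKW hEPW hp5 V₁ hred₁ hsurj₁ hunit₁ V (hiso V hCW)

/-! ## §4 The child 19590 and the rank-`0` half of the crux BY NAME, modulo the displayed partner demand -/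

/-- **Item 19590 `MultLambdaLower` BY NAME from Kato's half-eigen divisibility, EPW's semistable branch
transfer, and ONE certified partner per cell-(M) pair of analytic rank `≤ 1` at `p ≥ 5`** — for every such
pair `(W, p)`, SOME partner: `V₁` globally minimal, good ordinary or multiplicative at `p`, `ρ_{V₁,pⁿ}` onto
(all `n`), unit branch `p`-adic `L`-function ((C2)), and (C1) a `Γ_ℚ`-equivariant `V₁[p] ≃ V[p]` for the
globally minimal twist models `V` of `W` — together with the RAW Λ-adic input on the `p = 3` rows of the
cell (EPW's Hida theory is printed for `p ≥ 5`; route W2 / Kim's criterion is the `p = 3` instrument).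
CONDITIONAL on `hPartner` (not a theorem: classes with minimal `λ(ρ̄, ω^{(p−1)/2}) > 0`, or with
non-surjective `ρ̄`, have no such partner) and on `hThree`; closes nothing.
[cite: EmertonPollackWeston2006, Cor. 5.1.4 (arXiv p30), Ex. 5.3.1 (p32)] [cite: Kato2004Asterisque, Thm. 12.5 (4) (p. 222)]
[cite: SkinnerUrban2014, Thm. 3.6.4 (shape only)] -/
theorem multLambdaLower_of_katoHalf_of_branchTransfer_of_partners
    (hKW : Wuthrich2014.kato_halfEigenCharIdeal_dvd_cyclotomicPrime_of_surjective)
    (hEPW : EmertonPollackWeston2006.cor514_branchTransfer_semistable_of_torsionIso)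
    (hThree : ∀ (W : WeierstrassCurve ℚ) [W.IsElliptic] [W.IsGloballyMinimal] [Fact (Nat.Prime 3)],
      N10.CellM W 3 → W.analyticRank ≤ 1 →
      ∀ (V : WeierstrassCurve ℚ) [V.IsElliptic] [V.IsGloballyMinimal],
        (∃ C : VariableChange ℚ, C • V.quadraticTwist ((-1) ^ (3 / 2) * 3 : ℚ) = W) →
          QuadraticBranchLowerDivisibilityAt V 3)
    (hPartner : ∀ (W : WeierstrassCurve ℚ) [W.IsElliptic] [W.IsGloballyMinimal] (p : ℕ) [Fact p.Prime],
      N10.CellM W p → W.analyticRank ≤ 1 → 5 ≤ p →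
      ∃ (V₁ : WeierstrassCurve ℚ) (_ : V₁.IsElliptic) (_ : V₁.IsGloballyMinimal),
        (IsOrdinaryAt V₁ p ∨ V₁.HasMultiplicativeReductionAtPrime p) ∧
        (∀ n : ℕ, V₁.HasSurjectiveModNGaloisRep (p ^ n : ℕ)) ∧
        (∀ {N : ℕ} [NeZero N] (f : CuspForm (Gamma0 N) 2) (B : PowerSeries ℚ_[p]),
          IsNewformOf V₁ f →
          ((IsOrdinaryAt V₁ p ∧
              B = if Even (p / 2) then padicLFunctionBranch f ((unitRoot V₁ p : ℤ_[p]) : ℚ_[p]) (p / 2)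
                else padicLFunctionMinusBranch f ((unitRoot V₁ p : ℤ_[p]) : ℚ_[p]) (p / 2)) ∨
            (V₁.HasSplitMultiplicativeReductionAtPrime p ∧
              B = if Even (p / 2) then padicLFunctionPlusBranchMult f (1 : ℚ_[p]) (p / 2)
                else padicLFunctionMinusBranchMult f (1 : ℚ_[p]) (p / 2)) ∨
            (V₁.HasMultiplicativeReductionAtPrime p ∧ ¬ V₁.HasSplitMultiplicativeReductionAtPrime p ∧
              B = if Even (p / 2) then padicLFunctionPlusBranchMult f (-1 : ℚ_[p]) (p / 2)
                else padicLFunctionMinusBranchMult f (-1 : ℚ_[p]) (p / 2))) →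
          ∀ (ϖ : ℚ), (if Even (p / 2) then (ϖ : ℝ) * V₁.realPeriodRat = plusPeriod f
            else (ϖ : ℝ) * V₁.imaginaryPeriodRat = minusPeriod f) →
          ‖PowerSeries.constantCoeff (PowerSeries.C (ϖ : ℚ_[p]) * B)‖ = 1) ∧
        ∀ (V : WeierstrassCurve ℚ) [V.IsElliptic] [V.IsGloballyMinimal],
          (∃ C : VariableChange ℚ, C • V.quadraticTwist ((-1) ^ (p / 2) * p : ℚ) = W) →
          ∃ e : geomTorsion V₁ (p : ℤ) ≃+ geomTorsion V (p : ℤ),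
            ∀ (σ : Field.absoluteGaloisGroup ℚ) (P : geomTorsion V₁ (p : ℤ)), e (σ • P) = σ • e P) :
    MultLambdaLower := by
  intro W _ _ p _ hc hr V _ _ hCW
  -- `p` is odd: either `p = 3` (raw input) or `p ≥ 5` (partner road)
  have hp' : (p : ℕ).Prime := Fact.out
  rcases Nat.lt_or_ge p 5 with hlt | hp5
  · have hp3 : p = 3 := by
      have h2 := hp'.two_le
      have hne2 : p ≠ 2 := hc.1
      have h4 : p ≠ 4 := by rintro h4; rw [h4] at hp'; exact absurd hp' (by decide)
      omega
    subst hp3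
    exact hThree W hc hr V hCW
  · obtain ⟨V₁, _, _, hred₁, hsurj₁, hunit₁, hiso⟩ := hPartner W p hc hr hp5
    exact quadraticBranchLowerDivisibilityAt_of_partner hKW hEPW hp5 V₁ hred₁ hsurj₁ hunit₁ V (hiso V hCW)

/-- **The registered stub `stub_rankZero` = `N10.LowerHalfM` (the rank-`0` half of crux `MultLower`)
from the route's facts, `hKW`, `hEPW`, and ONE certified partner per CONTENT rank-`0` cell-(M) pair at
`p ≥ 5`** (content = `#Ш(W)_an` of positive `p`-adic valuation whenever rational; the other rows close
trivially by `N10.missingLowerBoundAt_of_padicValRat_le_zero`), plus the raw Λ-adic input on the content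
`p = 3` rows. Per pair: §3. CONDITIONAL on `hPartner` / `hThree`; closes nothing.
[cite: EmertonPollackWeston2006, Cor. 5.1.4 (arXiv p30), Ex. 5.3.1 (p32)] [cite: Delbourgo1998, Prop. 4 (p. 144)]
[cite: Pal2012, Thm. 3.2] [cite: Miller2011LMS, Def. 1.1] -/
theorem lowerHalfM_of_facts_of_partners
    (hDelX : Delbourgo1998.prop4_rankZero_constantCoeff_eq_unit_mul_of_potMult)
    (hPal : Pal2012.thm32_sqrt_mul_realPeriodRat_twist_eq_of_prime_one_mod_four)
    (hGZK : rank_eq_analyticRank_of_analyticRank_le_one) (hmod : hasEntireLFunction_rat)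
    (hmodD : nonempty_modularParametrizationData)
    (hKW : Wuthrich2014.kato_halfEigenCharIdeal_dvd_cyclotomicPrime_of_surjective)
    (hEPW : EmertonPollackWeston2006.cor514_branchTransfer_semistable_of_torsionIso)
    (hThree : ∀ (W : WeierstrassCurve ℚ) [W.IsElliptic] [W.IsGloballyMinimal] [Fact (Nat.Prime 3)],
      N10.CellM W 3 → W.analyticRank = 0 → (∀ q : ℚ, shaAn W = (q : ℂ) → 0 < padicValRat 3 q) →
      ∀ (V : WeierstrassCurve ℚ) [V.IsElliptic] [V.IsGloballyMinimal],
        (∃ C : VariableChange ℚ, C • V.quadraticTwist ((-1) ^ (3 / 2) * 3 : ℚ) = W) →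
          QuadraticBranchLowerDivisibilityAt V 3)
    (hPartner : ∀ (W : WeierstrassCurve ℚ) [W.IsElliptic] [W.IsGloballyMinimal] (p : ℕ) [Fact p.Prime],
      N10.CellM W p → W.analyticRank = 0 → 5 ≤ p →
      (∀ q : ℚ, shaAn W = (q : ℂ) → 0 < padicValRat p q) →
      ∃ (V₁ : WeierstrassCurve ℚ) (_ : V₁.IsElliptic) (_ : V₁.IsGloballyMinimal),
        (IsOrdinaryAt V₁ p ∨ V₁.HasMultiplicativeReductionAtPrime p) ∧
        (∀ n : ℕ, V₁.HasSurjectiveModNGaloisRep (p ^ n : ℕ)) ∧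
        (∀ {N : ℕ} [NeZero N] (f : CuspForm (Gamma0 N) 2) (B : PowerSeries ℚ_[p]),
          IsNewformOf V₁ f →
          ((IsOrdinaryAt V₁ p ∧
              B = if Even (p / 2) then padicLFunctionBranch f ((unitRoot V₁ p : ℤ_[p]) : ℚ_[p]) (p / 2)
                else padicLFunctionMinusBranch f ((unitRoot V₁ p : ℤ_[p]) : ℚ_[p]) (p / 2)) ∨
            (V₁.HasSplitMultiplicativeReductionAtPrime p ∧
              B = if Even (p / 2) then padicLFunctionPlusBranchMult f (1 : ℚ_[p]) (p / 2)
                else padicLFunctionMinusBranchMult f (1 : ℚ_[p]) (p / 2)) ∨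
            (V₁.HasMultiplicativeReductionAtPrime p ∧ ¬ V₁.HasSplitMultiplicativeReductionAtPrime p ∧
              B = if Even (p / 2) then padicLFunctionPlusBranchMult f (-1 : ℚ_[p]) (p / 2)
                else padicLFunctionMinusBranchMult f (-1 : ℚ_[p]) (p / 2))) →
          ∀ (ϖ : ℚ), (if Even (p / 2) then (ϖ : ℝ) * V₁.realPeriodRat = plusPeriod f
            else (ϖ : ℝ) * V₁.imaginaryPeriodRat = minusPeriod f) →
          ‖PowerSeries.constantCoeff (PowerSeries.C (ϖ : ℚ_[p]) * B)‖ = 1) ∧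
        ∀ (V : WeierstrassCurve ℚ) [V.IsElliptic] [V.IsGloballyMinimal],
          (∃ C : VariableChange ℚ, C • V.quadraticTwist ((-1) ^ (p / 2) * p : ℚ) = W) →
          ∃ e : geomTorsion V₁ (p : ℤ) ≃+ geomTorsion V (p : ℤ),
            ∀ (σ : Field.absoluteGaloisGroup ℚ) (P : geomTorsion V₁ (p : ℤ)), e (σ • P) = σ • e P) :
    N10.LowerHalfM := by
  intro W _ _ p _ hr hc
  have hp' : (p : ℕ).Prime := Fact.out
  -- non-content rows close trivially
  by_cases hq : ∃ q : ℚ, shaAn W = (q : ℂ) ∧ padicValRat p q ≤ 0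
  · obtain ⟨q, hq, hv⟩ := hq
    exact N10.missingLowerBoundAt_of_padicValRat_le_zero W p hq hv
  push Not at hq
  rcases Nat.lt_or_ge p 5 with hlt | hp5
  · have hp3 : p = 3 := by
      have h2 := hp'.two_le
      have hne2 : p ≠ 2 := hc.1
      have h4 : p ≠ 4 := by rintro h4; rw [h4] at hp'; exact absurd hp' (by decide)
      omega
    subst hp3
    exact missingLowerBoundAt_rankZero_of_cellM_of_quadraticBranchLower hDelX hPal hGZK hmod hmodD hc hr
      (hThree W hc hr hq)
  · obtain ⟨V₁, _, _, hred₁, hsurj₁, hunit₁, hiso⟩ := hPartner W p hc hr hp5 hq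
    exact missingLowerBoundAt_rankZero_of_cellM_of_partner hDelX hPal hGZK hmod hmodD hKW hEPW hc hp5 hr V₁
      hred₁ hsurj₁ hunit₁ hiso

end Summit.BirchSwinnertonDyer.BirchSwinnertonDyer.Theorems.AdditiveBranchIMCMultLowerCongruence

end
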